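import Literature.Analysis.Calculus.MatrixFieldDeriv
import Literature.Analysis.Calculus.LiouvilleDeterminant
import Mathlib.Analysis.SpecialFunctions.ExpDeriv
import Mathlib.Analysis.Calculus.Deriv.Prod
import Mathlib.Analysis.Calculus.Deriv.Mul
import Mathlib.MeasureTheory.Integral.IntervalIntegral.FundThmCalculus
import Mathlib.MeasureTheory.Integral.DominatedConvergence
import Mathlib.LinearAlgebra.Trace
import Mathlib.Topology.Algebra.Module.FiniteDimension
import Mathlib.Topology.Instances.Matrix
import HarnessLib

/-!
# The Abel–Liouville–Jacobi formula: `det J(t) = exp ∫₀ᵗ tr A` for `J' = A J`, `J(0) = 1`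

Topic `Literature/Analysis/ODE`; theorems only, no named facts. For a curve of operators
`J : ℝ → E →L[ℝ] E` on a finite-dimensional real normed space solving the linear equation
`J'(t) = A(t) J(t)` (pointwise: `d/dt (J(t) v) = A(t) (J(t) v)` for every vector `v`, right
derivatives on `[0, T)`), with `A` continuous on `[0, T]` and `J(0) = 1`,

  `det J(t) = exp (∫₀ᵗ tr A(s) ds)`   (`t ∈ [0, T]`).

This is Liouville's formula (Abel–Jacobi–Liouville identity) for linear systems
(Coddington–Levinson, *Theory of Ordinary Differential Equations* (1955), Ch. I §7 / Ch. III
(1.5) "`det Φ(t) = det Φ(τ) exp ∫_τ^t tr A(s) ds`"; Hartman, *ODE*, Ch. IV Thm 1.2; Arnold,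
*ODE* §27.6 (Liouville's theorem `dV/dt = ∫ div`)). Its use in the tree: the Jacobian of the
flow of a vector field `Y` along a trajectory is `exp ∫ div Y`, in particular CONSTANT
`e^{t div Y}` for fields of constant divergence (damped Hamiltonian systems: the Langevin /
Rey-Bellet–Thomas drifts), which gives the change-of-variables formula behind the duality
(time reversal) of their transition semigroups with respect to Lebesgue measure.

* `sum_det_updateRow_mul_eq` — the trace identity `∑ⱼ det (M with row j := (B M)ⱼ) = det M · tr B`
  for every finite index type (Laplace expansion along the replaced row,
  `det_updateRow_eq_sum_mul_adjugate` of `MatrixFieldDeriv.lean`, and `M · adj M = det M · 1`);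
  this discharges the "generalisation debt" recorded in `LiouvilleDeterminant.lean` (there `3 × 3`).
* `hasDerivWithinAt_det_of_pointwise` — **Jacobi's formula for operator curves**: if
  `u ↦ J u v` has derivative `B (J t v)` at `t` within `s` for every `v`, then `u ↦ det (J u)` has
  derivative `det (J t) · tr B` (coordinates in a basis, `hasDerivWithinAt_det_rows`).
* `hasDerivWithinAt_integral_of_continuousOn`, `continuousOn_integral_of_continuousOn` — FTC
  helpers for integrands continuous on `[0, T]` only (right derivatives on `[0, T)`).
* `det_eq_exp_integral_trace` — **Liouville's formula** as displayed above
  (`φ = det J · exp(-∫ tr A)` has zero right derivative, `constant_of_has_deriv_right_zero`).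

## References

* E. A. Coddington, N. Levinson, *Theory of Ordinary Differential Equations* (1955), Ch. I §7,
  Ch. III §1 (Abel–Liouville formula).
* P. Hartman, *Ordinary Differential Equations* (2nd ed., 1982), Ch. IV, Thm 1.2.
* V. I. Arnold, *Ordinary Differential Equations* (1992), §27.6 (Liouville's theorem). [folklore]
-/

noncomputable section

open Set Filter Topology Matrix Function MeasureTheory
open scoped Matrix

namespace Literature.Analysis.ODE

open Literature.Analysis.Calculus

/-! ### The trace identity in every dimension -/

section Trace

variable {ι : Type*} [Fintype ι] [DecidableEq ι]

/-- **`∑ⱼ det (M with row j := (B M)ⱼ) = det M · tr B`** (general finite index type): Laplace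
expansion along the replaced row gives `∑ⱼ ∑ᵢ (BM)ⱼᵢ adj(M)ᵢⱼ = tr (B M adj M)`, and
`M adj M = det M · 1`. [folklore] -/
theorem sum_det_updateRow_mul_eq (M B : Matrix ι ι ℝ) :
    ∑ j, (M.updateRow j ((B * M) j)).det = M.det * B.trace := by
  have h : ∀ j, (M.updateRow j ((B * M) j)).det = ∑ i, (B * M) j i * M.adjugate i j := fun j =>
    det_updateRow_eq_sum_mul_adjugate M j _
  simp_rw [h]
  have h2 : ∑ j, ∑ i, (B * M) j i * M.adjugate i j = (B * M * M.adjugate).trace := by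
    simp only [Matrix.trace, Matrix.diag]
    refine Finset.sum_congr rfl fun j _ => ?_
    rw [Matrix.mul_apply]
  rw [h2, Matrix.mul_assoc, mul_adjugate, Matrix.mul_smul, Matrix.mul_one, trace_smul, smul_eq_mul,
    mul_comm]

end Trace

/-! ### Jacobi's formula for operator curves (pointwise derivatives) -/

variable {E : Type*} [NormedAddCommGroup E] [NormedSpace ℝ E] [FiniteDimensional ℝ E]

/-- **Jacobi's formula for a curve of operators, from pointwise derivatives**: if for every
vector `v` the curve `u ↦ J u v` has derivative `B (J t v)` at `t` within `s`, then
`u ↦ det (J u)` has derivative `det (J t) · tr B` at `t` within `s`. [folklore] -/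
theorem hasDerivWithinAt_det_of_pointwise {J : ℝ → E →L[ℝ] E} {B : E →L[ℝ] E} {s : Set ℝ} {t : ℝ}
    (hJ : ∀ v, HasDerivWithinAt (fun u => J u v) (B (J t v)) s t) :
    HasDerivWithinAt (fun u => (J u).det)
      ((J t).det * LinearMap.trace ℝ E (B : E →ₗ[ℝ] E)) s t := by
  classical
  set b := Module.finBasis ℝ E with hb
  -- the matrix entries of `J u` and of `B ∘ J t`
  set m : ℝ → Fin (Module.finrank ℝ E) → Fin (Module.finrank ℝ E) → ℝ :=
    fun u i j => b.repr (J u (b j)) i with hm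
  set m' : Fin (Module.finrank ℝ E) → Fin (Module.finrank ℝ E) → ℝ :=
    fun i j => b.repr (B (J t (b j))) i with hm'
  have hm_eq : ∀ u, Matrix.of (m u) = LinearMap.toMatrix b b (J u : E →ₗ[ℝ] E) := by
    intro u
    ext i j
    rw [Matrix.of_apply, LinearMap.toMatrix_apply]
    rfl
  have hm'_eq : Matrix.of m' =
      LinearMap.toMatrix b b (B : E →ₗ[ℝ] E) * LinearMap.toMatrix b b (J t : E →ₗ[ℝ] E) := by
    rw [← LinearMap.toMatrix_comp b b b]
    ext i j
    rw [Matrix.of_apply, LinearMap.toMatrix_apply]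
    rfl
  -- entrywise derivatives
  have hderiv : HasDerivWithinAt m m' s t := by
    rw [hasDerivWithinAt_pi]
    intro i
    rw [hasDerivWithinAt_pi]
    intro j
    have hℓ := (LinearMap.toContinuousLinearMap (b.coord i)).hasFDerivAt.comp_hasDerivWithinAt t
      (hJ (b j))
    exact hℓ
  have hdet := hasDerivWithinAt_det_rows hderiv
  -- identification of the value and of the derivative
  have hval : ∀ u, (Matrix.of (m u)).det = (J u).det := fun u => by
    rw [hm_eq, LinearMap.det_toMatrix]
  have hsum : ∑ j, (Matrix.of (update (m t) j (m' j))).det =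
      (J t).det * LinearMap.trace ℝ E (B : E →ₗ[ℝ] E) := by
    have h1 : ∀ j, Matrix.of (update (m t) j (m' j)) =
        (Matrix.of (m t)).updateRow j ((Matrix.of m') j) := fun j => rfl
    simp_rw [h1]
    rw [hm'_eq, hm_eq, sum_det_updateRow_mul_eq, LinearMap.det_toMatrix,
      ← LinearMap.trace_eq_matrix_trace]
  have h := hdet.congr_deriv hsum
  refine h.congr (fun u _ => (hval u).symm) (hval t).symm

/-! ### FTC helpers for integrands continuous on `[0, T]` -/

section FTC

variable {F : Type*} [NormedAddCommGroup F] [NormedSpace ℝ F] [CompleteSpace F]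

omit [NormedSpace ℝ F] [CompleteSpace F] in
/-- A function continuous on `[0, T]`, continuously extended by constants. [folklore] -/
theorem exists_continuous_extend {f : ℝ → F} {T : ℝ} (hT : 0 ≤ T) (hf : ContinuousOn f (Icc 0 T)) :
    ∃ g : ℝ → F, Continuous g ∧ EqOn g f (Icc 0 T) := by
  refine ⟨IccExtend hT fun x : Icc 0 T => f x, ?_, fun x hx => ?_⟩
  · exact (continuousOn_iff_continuous_restrict.1 hf).Icc_extend'
  · rw [IccExtend_of_mem hT _ hx]

/-- **Right derivative of the primitive of a function continuous on `[0, T]`**: for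
`t ∈ [0, T)`, `u ↦ ∫₀ᵘ f` has derivative `f t` at `t` within `[t, ∞)`. [folklore] -/
theorem hasDerivWithinAt_integral_of_continuousOn {f : ℝ → F} {T : ℝ}
    (hf : ContinuousOn f (Icc 0 T)) {t : ℝ} (ht : t ∈ Ico 0 T) :
    HasDerivWithinAt (fun u => ∫ s in (0 : ℝ)..u, f s) (f t) (Ici t) t := by
  have hT : 0 ≤ T := ht.1.trans ht.2.le
  obtain ⟨g, hgc, hg⟩ := exists_continuous_extend hT hf
  have hG : HasDerivAt (fun u => ∫ s in (0 : ℝ)..u, g s) (g t) t :=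
    intervalIntegral.integral_hasDerivAt_right (hgc.intervalIntegrable _ _)
      (hgc.stronglyMeasurableAtFilter _ _) hgc.continuousAt
  rw [hg ⟨ht.1, ht.2.le⟩] at hG
  have heq : EqOn (fun u => ∫ s in (0 : ℝ)..u, f s) (fun u => ∫ s in (0 : ℝ)..u, g s) (Icc t T) := by
    intro u hu
    refine intervalIntegral.integral_congr fun s hs => ?_
    rw [uIcc_of_le (ht.1.trans hu.1)] at hs
    exact (hg ⟨hs.1, hs.2.trans hu.2⟩).symm
  have h1 : HasDerivWithinAt (fun u => ∫ s in (0 : ℝ)..u, f s) (f t) (Icc t T) t :=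
    (hG.hasDerivWithinAt (s := Icc t T)).congr heq (heq ⟨le_rfl, ht.2.le⟩)
  exact h1.mono_of_mem_nhdsWithin (Icc_mem_nhdsGE ht.2)

omit [CompleteSpace F] in
/-- The primitive of a function continuous on `[0, T]` is continuous on `[0, T]`. [folklore] -/
theorem continuousOn_integral_of_continuousOn {f : ℝ → F} {T : ℝ} (hT : 0 ≤ T)
    (hf : ContinuousOn f (Icc 0 T)) :
    ContinuousOn (fun u => ∫ s in (0 : ℝ)..u, f s) (Icc 0 T) := by
  obtain ⟨g, hgc, hg⟩ := exists_continuous_extend hT hf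
  have hG : Continuous fun u => ∫ s in (0 : ℝ)..u, g s :=
    intervalIntegral.continuous_primitive (fun _ _ => hgc.intervalIntegrable _ _) 0
  refine hG.continuousOn.congr fun u hu => ?_
  refine intervalIntegral.integral_congr fun s hs => ?_
  rw [uIcc_of_le hu.1] at hs
  exact (hg ⟨hs.1, hs.2.trans hu.2⟩).symm

end FTC

/-! ### Liouville's formula -/

/-- The trace of a continuous linear endomorphism depends continuously on it. [folklore] -/
theorem continuous_trace_clm :
    Continuous fun L : E →L[ℝ] E => LinearMap.trace ℝ E (L : E →ₗ[ℝ] E) :=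
  ((LinearMap.trace ℝ E).comp (ContinuousLinearMap.coeLM ℝ)).continuous_of_finiteDimensional

/-- The determinant `u ↦ det (J u)` is continuous on `[0, T]` if `u ↦ J u v` is, for every `v`.
[folklore] -/
theorem continuousOn_det_of_pointwise {J : ℝ → E →L[ℝ] E} {S : Set ℝ}
    (hJc : ∀ v, ContinuousOn (fun s => J s v) S) : ContinuousOn (fun u => (J u).det) S := by
  classical
  set b := Module.finBasis ℝ E with hb
  set m : ℝ → Matrix (Fin (Module.finrank ℝ E)) (Fin (Module.finrank ℝ E)) ℝ :=
    fun u => LinearMap.toMatrix b b (J u : E →ₗ[ℝ] E) with hm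
  have hval : ∀ u, (m u).det = (J u).det := fun u => by
    rw [hm, LinearMap.det_toMatrix]
  have hmc : ContinuousOn m S := by
    refine continuousOn_pi.2 fun i => continuousOn_pi.2 fun j => ?_
    have h : (fun u => m u i j) = fun u => b.repr (J u (b j)) i := by
      funext u
      simp only [hm, LinearMap.toMatrix_apply]
      rfl
    rw [h]
    exact (LinearMap.toContinuousLinearMap (b.coord i)).continuous.comp_continuousOn (hJc (b j))
  have hdet : ContinuousOn (fun u => (m u).det) S :=
    (continuous_id.matrix_det).comp_continuousOn hmc
  exact hdet.congr fun u _ => (hval u).symm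

/-- **Liouville's formula (Abel–Jacobi–Liouville).** Let `J, A : ℝ → E →L[ℝ] E` with `A`
continuous on `[0, T]`, `u ↦ J u v` continuous on `[0, T]` for every `v`, `J 0 = 1`, and the
linear equation `d/du (J u v) = A t (J t v)` holding as a right derivative at every `t ∈ [0, T)`
and every `v`. Then `det J(t) = exp (∫₀ᵗ tr A(s) ds)` for all `t ∈ [0, T]`
(Coddington–Levinson Ch. III (1.5); Hartman Ch. IV Thm 1.2). [folklore] -/
theorem det_eq_exp_integral_trace {J A : ℝ → E →L[ℝ] E} {T : ℝ} (hT : 0 ≤ T)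
    (hA : ContinuousOn A (Icc 0 T)) (hJc : ∀ v, ContinuousOn (fun s => J s v) (Icc 0 T))
    (hJ' : ∀ v, ∀ t ∈ Ico 0 T, HasDerivWithinAt (fun u => J u v) (A t (J t v)) (Ici t) t)
    (hJ0 : J 0 = ContinuousLinearMap.id ℝ E) :
    ∀ t ∈ Icc 0 T,
      (J t).det = Real.exp (∫ s in (0 : ℝ)..t, LinearMap.trace ℝ E (A s : E →ₗ[ℝ] E)) := by
  set tr : ℝ → ℝ := fun s => LinearMap.trace ℝ E (A s : E →ₗ[ℝ] E) with htr_def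
  have htr : ContinuousOn tr (Icc 0 T) := continuous_trace_clm.comp_continuousOn hA
  set D : ℝ → ℝ := fun u => (J u).det with hD_def
  have hD' : ∀ t ∈ Ico 0 T, HasDerivWithinAt D (D t * tr t) (Ici t) t := fun t ht =>
    hasDerivWithinAt_det_of_pointwise fun v => hJ' v t ht
  have hDc : ContinuousOn D (Icc 0 T) := continuousOn_det_of_pointwise hJc
  set P : ℝ → ℝ := fun u => ∫ s in (0 : ℝ)..u, tr s with hP_def
  have hP' : ∀ t ∈ Ico 0 T, HasDerivWithinAt P (tr t) (Ici t) t := fun t ht =>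
    hasDerivWithinAt_integral_of_continuousOn htr ht
  have hPc : ContinuousOn P (Icc 0 T) := continuousOn_integral_of_continuousOn hT htr
  -- `φ = D · exp (-P)` has zero right derivative
  set φ : ℝ → ℝ := fun u => D u * Real.exp (-P u) with hφ_def
  have hφc : ContinuousOn φ (Icc 0 T) := hDc.mul (hPc.neg.rexp)
  have hφeq : φ = D * fun x => Real.exp ((-P) x) := by
    funext u
    simp [hφ_def]
  have hφ' : ∀ t ∈ Ico 0 T, HasDerivWithinAt φ 0 (Ici t) t := by
    intro t ht
    have h := (hD' t ht).mul ((hP' t ht).neg.exp)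
    rw [hφeq]
    exact h.congr_deriv (by simp only [Pi.neg_apply]; ring)
  have hconst := constant_of_has_deriv_right_zero hφc hφ'
  have hD0 : D 0 = 1 := by
    simp only [hD_def, hJ0]
    exact LinearMap.det_id
  have hP0 : P 0 = 0 := by simp [hP_def]
  intro t ht
  have h := hconst t ht
  simp only [hφ_def, hD0, hP0, neg_zero, Real.exp_zero, mul_one] at h
  -- `D t * exp (-P t) = 1`
  have hexp : Real.exp (-P t) ≠ 0 := (Real.exp_pos _).ne'
  calc (J t).det = D t := rfl
    _ = D t * Real.exp (-P t) * Real.exp (P t) := by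
        rw [mul_assoc, ← Real.exp_add, neg_add_cancel, Real.exp_zero, mul_one]
    _ = Real.exp (P t) := by rw [h, one_mul]

/-- Liouville's formula for a CONSTANT trace: if moreover `tr A(s) = d` on `[0, T]`, then
`det J(t) = e^{d t}`. [folklore] -/
theorem det_eq_exp_mul_of_trace_eq {J A : ℝ → E →L[ℝ] E} {T : ℝ} (hT : 0 ≤ T)
    (hA : ContinuousOn A (Icc 0 T)) (hJc : ∀ v, ContinuousOn (fun s => J s v) (Icc 0 T))
    (hJ' : ∀ v, ∀ t ∈ Ico 0 T, HasDerivWithinAt (fun u => J u v) (A t (J t v)) (Ici t) t)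
    (hJ0 : J 0 = ContinuousLinearMap.id ℝ E) {d : ℝ}
    (hd : ∀ s ∈ Icc 0 T, LinearMap.trace ℝ E (A s : E →ₗ[ℝ] E) = d) :
    ∀ t ∈ Icc 0 T, (J t).det = Real.exp (d * t) := by
  intro t ht
  rw [det_eq_exp_integral_trace hT hA hJc hJ' hJ0 t ht]
  congr 1
  have h : ∫ s in (0 : ℝ)..t, LinearMap.trace ℝ E (A s : E →ₗ[ℝ] E) = ∫ _ in (0 : ℝ)..t, d := by
    refine intervalIntegral.integral_congr fun s hs => ?_
    rw [uIcc_of_le ht.1] at hs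
    exact hd s ⟨hs.1, hs.2.trans ht.2⟩
  rw [h, intervalIntegral.integral_const, smul_eq_mul, sub_zero, mul_comm]

end Literature.Analysis.ODE
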